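import Mathlib
import Summits.Ventures.PercRepro2.LeafRowEdgeCubic
import Summits.Ventures.PercRepro2.LeafRowFirstOrderA
import Summits.Ventures.PercRepro2.FirstOrderPendant
import Summits.Ventures.PercRepro2.LeafHalfCross

/-!
# Row (LEAF-½) at a pendant root: the closed pin vanishes, and the one-copy Bernstein
coefficient is the sum of the five first-order pieces (blind cell PercRepro2, p5 g29;
`proofs/P5-OEDGE.md` §39 (12))

Let the root `a₂` be a LEAF: its only edge is `e = {a₂, z}`.  At the closed pin `p[e↦0]` the root is
isolated, every `C₂`-mass vanishes, `P(Q) = 1` (`FirstOrderPendantClosed.closed_*`, here also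
`closed_mU`, `closed_mUU`), and **`Rhalf_closed_pendant_eq_zero`**: `R½ p[e↦0] = 0`.  The one-copy
Bernstein coefficient `LeafRowEdgeCubic.B1h` of the root edge is then EXACTLY the sum of the five
first-order pieces of `R½ = margin + crossA + crossA′ + crossB + crossB′` at the open pin
(**`B1h_eq_fo`**; the closed-pin scalars are flip-invariant, `KPrime.flipInvAt_*`; the open-pin
masses are the `Q`-pattern masses; then `ring1`):

  `B1h = crossAfo + crossA′fo + marginfo + crossBfo + crossB′fo`

with `crossAfo` of `LeafRowFirstOrderA.lean` (≥ 0, the exploration of `C(a₂)`), `crossA′fo` a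
probability, `marginfo` and `crossBfo` monotonicity slacks of the form `FirstOrder.Bfo` (≥ 0), and
`crossB′fo` the first-order coefficient of theorem (B)'s mirror term.  Own work; standard axioms.
-/

namespace Summit.Ventures.PercRepro2

open UnionCluster CovForm CovForm.FirstOrder CovForm.EdgeLine LeafStep LeafHalfCross
  LeafRowEdgeCubic LeafRowFirstOrderA

namespace LeafRowPendantRootFO

section ClosedPin

variable {V : Type*} {E : Type*} [Fintype E] [DecidableEq E] [Fintype V] [DecidableEq V]
  {R : Type*} [Field R] [LinearOrder R] [IsStrictOrderedRing R]
variable {ends : E → Sym2 V} {p : E → R} {e : E} {a₂ : V}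

omit [Fintype V] [DecidableEq V] [LinearOrder R] [IsStrictOrderedRing R] in
/-- `mU(x) = P(x ∈ C₁)` at the closed pin. -/
lemma closed_mU (hleaf : ∀ f, a₂ ∈ ends f → f = e) {a₁ x : V} (h1 : a₁ ≠ a₂) (hx : x ≠ a₂) :
    mU (Function.update p e 0) ends a₁ a₂ x =
      prob (Function.update p e 0) (connEvent ends a₁ x) := by
  unfold mU
  rw [closed_Q_inter hleaf h1 (connEvent ends a₁ x),
    prob_closed_eq_zero_of_subset hleaf hx (A := avoidAll ends a₂ {a₁} ∩ connEvent ends a₂ x)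
      (fun _ h => h.2), add_zero]

omit [Fintype V] [DecidableEq V] [LinearOrder R] [IsStrictOrderedRing R] in
/-- `mUU = P(o, b ∈ C₁)` at the closed pin. -/
lemma closed_mUU (hleaf : ∀ f, a₂ ∈ ends f → f = e) {o a₁ b : V} (ho : o ≠ a₂) (h1 : a₁ ≠ a₂)
    (hb : b ≠ a₂) :
    mUU (Function.update p e 0) ends o a₁ a₂ b =
      prob (Function.update p e 0) (connEvent ends a₁ o ∩ connEvent ends a₁ b) := by
  unfold mUU
  rw [closed_Q_inter hleaf h1 (connEvent ends a₁ o ∩ connEvent ends a₁ b),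
    prob_closed_eq_zero_of_subset hleaf ho
      (A := avoidAll ends a₂ {a₁} ∩ (connEvent ends a₂ o ∩ connEvent ends a₂ b)) (fun _ h => h.2.1),
    prob_closed_eq_zero_of_subset hleaf ho
      (A := avoidAll ends a₂ {a₁} ∩ (connEvent ends a₂ o ∩ connEvent ends a₁ b)) (fun _ h => h.2.1),
    prob_closed_eq_zero_of_subset hleaf hb
      (A := avoidAll ends a₂ {a₁} ∩ (connEvent ends a₁ o ∩ connEvent ends a₂ b)) (fun _ h => h.2.2)]
  ring

omit [Fintype V] [DecidableEq V] in
/-- **The closed pin of a pendant root edge has `R½ = 0`** (the isolated root). -/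
theorem Rhalf_closed_pendant_eq_zero (hleaf : ∀ f, a₂ ∈ ends f → f = e) {o a₁ v b : V}
    (ho : o ≠ a₂) (h1 : a₁ ≠ a₂) (hv : v ≠ a₂) (hb : b ≠ a₂) :
    Rhalf (Function.update p e 0) ends o a₁ a₂ v b = 0 := by
  rw [Rhalf_eq_RhalfPoly, closed_Q hleaf h1, closed_EQbo hleaf ho h1 hb v, closed_EQb3 hleaf h1 hv hb,
    closed_EQb3o hleaf ho h1 hv hb, closed_EQo hleaf ho h1 v, closed_EQ3 hleaf h1 hv,
    closed_EQ3o hleaf ho h1 hv, closed_PDb hleaf h1 hv hb, closed_PDbo hleaf ho h1 hv hb,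
    closed_Do hleaf ho h1 hv, closed_gap hleaf h1 hb v, closed_mU hleaf h1 ho, closed_mU hleaf h1 hb,
    closed_mU hleaf h1 hv, closed_mUU hleaf ho h1 hb]
  have s1 := split_a₃ (ends := ends) (Function.update p e 0) a₁ v (connEvent ends a₁ o)
  have s2 := split_a₃ (ends := ends) (Function.update p e 0) a₁ v (connEvent ends a₁ b)
  have s3 := split_a₃ (ends := ends) (Function.update p e 0) a₁ v (connEvent ends a₁ o ∩ connEvent ends a₁ b)
  have s4 := split_a₃ (ends := ends) (Function.update p e 0) a₁ v Set.univ
  rw [Set.inter_univ, Set.inter_univ, prob_univ] at s4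
  rw [s1, s2, s3, show prob (Function.update p e 0) (connEvent ends a₁ v) =
    1 - prob (Function.update p e 0) (avoidAll ends a₁ {v}) by linarith]
  unfold RhalfPoly
  ring

end ClosedPin

section Pieces

variable {V : Type*} {E : Type*} [Fintype E] [DecidableEq E] {R : Type*} [Field R]

/-- The first-order mirror (A)-term: `P(Q, v ∈ C₁, o ∈ C₂, b ∈ C₂)`, a probability. -/
noncomputable def crossA'fo (q : E → R) (ends : E → Sym2 V) (o a₁ a₂ v b : V) : R :=
  prob q (avoidAll ends a₂ {a₁} ∩ (connEvent ends a₁ v ∩ (connEvent ends a₂ o ∩ connEvent ends a₂ b)))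

/-- The first-order margin: `(1 − π_v)·[(π_b·P(Q, oH) − P(Q, oH, bL)) + (π_o·P(Q, bH) − P(Q, oL, bH))]`. -/
noncomputable def marginfo (q : E → R) (ends : E → Sym2 V) (o a₁ a₂ v b : V) : R :=
  (1 - prob q (connEvent ends a₁ v)) *
    ((prob q (connEvent ends a₁ b) * prob q (avoidAll ends a₂ {a₁} ∩ connEvent ends a₂ o) -
        prob q (avoidAll ends a₂ {a₁} ∩ (connEvent ends a₂ o ∩ connEvent ends a₁ b))) +
      (prob q (connEvent ends a₁ o) * prob q (avoidAll ends a₂ {a₁} ∩ connEvent ends a₂ b) -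
        prob q (avoidAll ends a₂ {a₁} ∩ (connEvent ends a₁ o ∩ connEvent ends a₂ b))))

/-- The first-order (B)-term: `[π_b·P(Q, oH) − P(Q, oH, bL)] − [π_b·P(Q, vH, oH) − P(Q, vH, oH, bL)]`. -/
noncomputable def crossBfo (q : E → R) (ends : E → Sym2 V) (o a₁ a₂ v b : V) : R :=
  (prob q (connEvent ends a₁ b) * prob q (avoidAll ends a₂ {a₁} ∩ connEvent ends a₂ o) -
      prob q (avoidAll ends a₂ {a₁} ∩ (connEvent ends a₂ o ∩ connEvent ends a₁ b))) -
    (prob q (connEvent ends a₁ b) *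
        prob q (avoidAll ends a₂ {a₁} ∩ (connEvent ends a₂ v ∩ connEvent ends a₂ o)) -
      prob q (avoidAll ends a₂ {a₁} ∩ (connEvent ends a₂ v ∩ (connEvent ends a₂ o ∩ connEvent ends a₁ b))))

/-- The first-order mirror (B)-term: `[π_o·P(Q, bH) − P(Q, oL, bH)] + π_o·[π_v·P(Q, bH) − P(Q, vL, bH)]
− π_{vo}·P(Q, bH) + P(Q, vL, oL, bH)`. -/
noncomputable def crossB'fo (q : E → R) (ends : E → Sym2 V) (o a₁ a₂ v b : V) : R :=
  (prob q (connEvent ends a₁ o) * prob q (avoidAll ends a₂ {a₁} ∩ connEvent ends a₂ b) -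
      prob q (avoidAll ends a₂ {a₁} ∩ (connEvent ends a₁ o ∩ connEvent ends a₂ b))) +
    prob q (connEvent ends a₁ o) *
      (prob q (connEvent ends a₁ v) * prob q (avoidAll ends a₂ {a₁} ∩ connEvent ends a₂ b) -
        prob q (avoidAll ends a₂ {a₁} ∩ (connEvent ends a₁ v ∩ connEvent ends a₂ b))) -
    prob q (connEvent ends a₁ v ∩ connEvent ends a₁ o) *
      prob q (avoidAll ends a₂ {a₁} ∩ connEvent ends a₂ b) +
    prob q (avoidAll ends a₂ {a₁} ∩ (connEvent ends a₁ v ∩ (connEvent ends a₁ o ∩ connEvent ends a₂ b)))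

end Pieces

section Dictionary

variable {V : Type*} {E : Type*} [Fintype E] [DecidableEq E] [Fintype V] [DecidableEq V]
  {R : Type*} [Field R] [LinearOrder R] [IsStrictOrderedRing R]
variable {ends : E → Sym2 V} {p : E → R} {e : E} {a₂ z : V}

omit [Fintype V] in
/-- **THE DICTIONARY**: at a pendant root edge `e = {a₂, z}`, the one-copy Bernstein coefficient of
`R½` is the sum of the five first-order pieces at the open pin. -/
theorem B1h_eq_fo (he : p e ≠ 1) (hleaf : ∀ f, a₂ ∈ ends f → f = e) (hends : ends e = s(a₂, z))
    {o a₁ v b : V} (ho : o ≠ a₂) (h1 : a₁ ≠ a₂) (hv : v ≠ a₂) (hb : b ≠ a₂) :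
    B1h p ends o a₁ a₂ v b e =
      crossAfo (Function.update p e 1) ends o a₁ a₂ v b +
        crossA'fo (Function.update p e 1) ends o a₁ a₂ v b +
        marginfo (Function.update p e 1) ends o a₁ a₂ v b +
        crossBfo (Function.update p e 1) ends o a₁ a₂ v b +
        crossB'fo (Function.update p e 1) ends o a₁ a₂ v b := by
  -- the closed-pin scalars are flip-invariant: `P₁ = P₀` on the `a₂`-free events
  have fc : ∀ x : V, x ≠ a₂ → prob (Function.update p e 1) (connEvent ends a₁ x) =
      prob (Function.update p e 0) (connEvent ends a₁ x) := fun x hx =>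
    KPrime.prob_update_one_eq_update_zero_of_flipInvAt he (KPrime.flipInvAt_connEvent hleaf hends h1 hx)
  have fcc : ∀ x y : V, x ≠ a₂ → y ≠ a₂ →
      prob (Function.update p e 1) (connEvent ends a₁ x ∩ connEvent ends a₁ y) =
      prob (Function.update p e 0) (connEvent ends a₁ x ∩ connEvent ends a₁ y) := fun x y hx hy =>
    KPrime.prob_update_one_eq_update_zero_of_flipInvAt he
      ((KPrime.flipInvAt_connEvent hleaf hends h1 hx).inter (KPrime.flipInvAt_connEvent hleaf hends h1 hy))
  have fccc : prob (Function.update p e 1)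
        (connEvent ends a₁ v ∩ (connEvent ends a₁ o ∩ connEvent ends a₁ b)) =
      prob (Function.update p e 0)
        (connEvent ends a₁ v ∩ (connEvent ends a₁ o ∩ connEvent ends a₁ b)) :=
    KPrime.prob_update_one_eq_update_zero_of_flipInvAt he
      ((KPrime.flipInvAt_connEvent hleaf hends h1 hv).inter
        ((KPrime.flipInvAt_connEvent hleaf hends h1 ho).inter (KPrime.flipInvAt_connEvent hleaf hends h1 hb)))
  have hvX : ∀ x ∈ ({v} : Finset V), x ≠ a₂ := fun x hx => by
    rw [Finset.mem_singleton] at hx; rw [hx]; exact hv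
  have fa : prob (Function.update p e 1) (avoidAll ends a₁ {v}) =
      prob (Function.update p e 0) (avoidAll ends a₁ {v}) :=
    KPrime.prob_update_one_eq_update_zero_of_flipInvAt he (KPrime.flipInvAt_avoidAll hleaf hends h1 hvX)
  have fa1 : ∀ x : V, x ≠ a₂ → prob (Function.update p e 1) (avoidAll ends a₁ {v} ∩ connEvent ends a₁ x) =
      prob (Function.update p e 0) (avoidAll ends a₁ {v} ∩ connEvent ends a₁ x) := fun x hx =>
    KPrime.prob_update_one_eq_update_zero_of_flipInvAt he
      ((KPrime.flipInvAt_avoidAll hleaf hends h1 hvX).inter (KPrime.flipInvAt_connEvent hleaf hends h1 hx))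
  have fa2 : prob (Function.update p e 1) (avoidAll ends a₁ {v} ∩ (connEvent ends a₁ o ∩ connEvent ends a₁ b)) =
      prob (Function.update p e 0) (avoidAll ends a₁ {v} ∩ (connEvent ends a₁ o ∩ connEvent ends a₁ b)) :=
    KPrime.prob_update_one_eq_update_zero_of_flipInvAt he
      ((KPrime.flipInvAt_avoidAll hleaf hends h1 hvX).inter
        ((KPrime.flipInvAt_connEvent hleaf hends h1 ho).inter (KPrime.flipInvAt_connEvent hleaf hends h1 hb)))
  -- the split relations at the open pin
  have s1 := split_a₃ (ends := ends) (Function.update p e 1) a₁ v (connEvent ends a₁ o)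
  have s2 := split_a₃ (ends := ends) (Function.update p e 1) a₁ v (connEvent ends a₁ b)
  have s3 := split_a₃ (ends := ends) (Function.update p e 1) a₁ v (connEvent ends a₁ o ∩ connEvent ends a₁ b)
  have s4 := split_a₃ (ends := ends) (Function.update p e 1) a₁ v Set.univ
  rw [Set.inter_univ, Set.inter_univ, prob_univ] at s4
  -- assemble
  unfold B1h
  rw [closed_Q hleaf h1, closed_EQbo hleaf ho h1 hb v, closed_EQb3 hleaf h1 hv hb,
    closed_EQb3o hleaf ho h1 hv hb, closed_EQo hleaf ho h1 v, closed_EQ3 hleaf h1 hv,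
    closed_EQ3o hleaf ho h1 hv, closed_PDb hleaf h1 hv hb, closed_PDbo hleaf ho h1 hv hb,
    closed_Do hleaf ho h1 hv, closed_gap hleaf h1 hb v, closed_mU hleaf h1 ho, closed_mU hleaf h1 hb,
    closed_mU hleaf h1 hv, closed_mUU hleaf ho h1 hb]
  rw [← fc o ho, ← fc b hb, ← fc v hv, ← fcc v o hv ho, ← fcc v b hv hb, ← fccc, ← fcc o b ho hb,
    ← fa, ← fa1 o ho, ← fa1 b hb, ← fa2]
  rw [show prob (Function.update p e 1) (avoidAll ends a₁ {v} ∩ connEvent ends a₁ o) =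
      prob (Function.update p e 1) (connEvent ends a₁ o) -
        prob (Function.update p e 1) (connEvent ends a₁ v ∩ connEvent ends a₁ o) by linarith,
    show prob (Function.update p e 1) (avoidAll ends a₁ {v} ∩ connEvent ends a₁ b) =
      prob (Function.update p e 1) (connEvent ends a₁ b) -
        prob (Function.update p e 1) (connEvent ends a₁ v ∩ connEvent ends a₁ b) by linarith,
    show prob (Function.update p e 1) (avoidAll ends a₁ {v} ∩ (connEvent ends a₁ o ∩ connEvent ends a₁ b)) =
      prob (Function.update p e 1) (connEvent ends a₁ o ∩ connEvent ends a₁ b) -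
        prob (Function.update p e 1) (connEvent ends a₁ v ∩ (connEvent ends a₁ o ∩ connEvent ends a₁ b)) by
      linarith,
    show prob (Function.update p e 1) (avoidAll ends a₁ {v}) =
      1 - prob (Function.update p e 1) (connEvent ends a₁ v) by linarith]
  unfold B1hPoly crossAfo crossA'fo marginfo crossBfo crossB'fo
  delta EQbo EQb3 EQb3o EQo EQ3 EQ3o PDb PDbo Do mU mUU
  rw [gap_eq_Q]
  simp only [prob_T_inter_v (Function.update p e 1) ends a₁ a₂ v,
    prob_T'_inter_v (Function.update p e 1) ends a₁ a₂ v,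
    prob_PD_inter_v (Function.update p e 1) ends a₁ a₂ v, prob_T_v (Function.update p e 1) ends a₁ a₂ v,
    prob_T'_v (Function.update p e 1) ends a₁ a₂ v]
  ring1

end Dictionary

section Nonneg

variable {V : Type*} {E : Type*} [Fintype E] [DecidableEq E] [Fintype V] [DecidableEq V]
  {R : Type*} [Field R] [LinearOrder R] [IsStrictOrderedRing R]
variable (q : E → R) (ends : E → Sym2 V)

omit [Fintype V] [DecidableEq V] in
/-- `crossA′fo` is a probability. -/
theorem crossA'fo_nonneg (hq : IsProbVec q) (o a₁ a₂ v b : V) :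
    0 ≤ crossA'fo q ends o a₁ a₂ v b :=
  prob_nonneg hq _

omit [Fintype E] [DecidableEq E] [Fintype V] [DecidableEq V] in
/-- A pair of `a₂`-cluster events is the cluster event of the pair family. -/
lemma connEvent_pair_eq_clusterInEvent (a₂ x y : V) :
    connEvent ends a₂ x ∩ connEvent ends a₂ y = clusterInEvent ends a₂ {W | x ∈ W ∧ y ∈ W} := by
  ext ω
  simp only [Set.mem_inter_iff, mem_connEvent, clusterInEvent, Set.mem_setOf_eq, mem_cluster]

omit [LinearOrder R] [IsStrictOrderedRing R] in
/-- **The monotonicity slack as an exploration**: for a family `𝓤` of `a₂`-clusters,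
`π_x·P(Q, C(a₂) ∈ 𝓤) − P(Q, C(a₂) ∈ 𝓤, x ∈ C₁) = E[1_𝓤(K)·1[a₁ ∉ K]·(π_x − g_x(K))]`. -/
lemma slack_eq_expect (a₁ a₂ x : V) (𝓤 : Set (Set V)) :
    prob q (connEvent ends a₁ x) * prob q (avoidAll ends a₂ {a₁} ∩ clusterInEvent ends a₂ 𝓤) -
        prob q (avoidAll ends a₂ {a₁} ∩ (clusterInEvent ends a₂ 𝓤 ∩ connEvent ends a₁ x)) =
      expect q (fun ω => 𝓤.indicator 1 (cluster ends ω a₂) *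
        (prob q (connEvent ends a₁ x) * outsideProb q ends a₁ Set.univ (cluster ends ω a₂) -
          outsideProb q ends a₁ {W | x ∈ W} (cluster ends ω a₂))) := by
  have e1 : avoidAll ends a₂ {a₁} ∩ clusterInEvent ends a₂ 𝓤 =
      clusterInEvent ends a₂ 𝓤 ∩ clusterInEvent ends a₁ Set.univ ∩ avoidAll ends a₂ (insert a₁ ∅) := by
    rw [Finset.insert_empty, clusterInEvent_univ]
    ext ω; simp only [Set.mem_inter_iff, Set.mem_univ, and_true]; tauto
  have e2 : avoidAll ends a₂ {a₁} ∩ (clusterInEvent ends a₂ 𝓤 ∩ connEvent ends a₁ x) =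
      clusterInEvent ends a₂ 𝓤 ∩ clusterInEvent ends a₁ {W | x ∈ W} ∩ avoidAll ends a₂ (insert a₁ ∅) := by
    rw [Finset.insert_empty, ← connEvent_eq_clusterInEvent]
    ext ω; simp only [Set.mem_inter_iff]; tauto
  rw [e1, e2, prob_clusterIn_outside_inter_avoid_eq_expect,
    prob_clusterIn_outside_inter_avoid_eq_expect, avoidAll_empty]
  simp only [Set.indicator_univ, Pi.one_apply, mul_one]
  rw [← expect_const_mul, ← expect_sub]
  congr 1
  funext ω
  simp only [Pi.sub_apply]
  ring

omit [Fintype V] [DecidableEq V] in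
/-- The exploration integrand of a monotonicity slack is pointwise nonnegative. -/
lemma slack_integrand_nonneg (hq : IsProbVec q) (a₁ a₂ x : V) (𝓤 : Set (Set V)) (ω : Config E) :
    0 ≤ 𝓤.indicator (1 : Set V → R) (cluster ends ω a₂) *
        (prob q (connEvent ends a₁ x) * outsideProb q ends a₁ Set.univ (cluster ends ω a₂) -
          outsideProb q ends a₁ {W | x ∈ W} (cluster ends ω a₂)) := by
  refine mul_nonneg (Set.indicator_apply_nonneg fun _ => zero_le_one) ?_
  by_cases ha : a₁ ∈ cluster ends ω a₂
  · rw [outsideProb_apply_of_mem q _ ha, outsideProb_apply_of_mem q _ ha]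
    simp
  · rw [outsideProb_apply_of_notMem q _ ha, outsideProb_apply_of_notMem q _ ha, delClusterProb_univ]
    have hx := delClusterProb_le_beta q hq ends a₁ x (cluster ends ω a₂)
    unfold beta at hx
    linarith

/-- **A monotonicity slack is nonnegative**: `π_x·P(Q, C(a₂) ∈ 𝓤) ≥ P(Q, C(a₂) ∈ 𝓤, x ∈ C₁)`. -/
theorem slack_nonneg (hq : IsProbVec q) (a₁ a₂ x : V) (𝓤 : Set (Set V)) :
    prob q (avoidAll ends a₂ {a₁} ∩ (clusterInEvent ends a₂ 𝓤 ∩ connEvent ends a₁ x)) ≤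
      prob q (connEvent ends a₁ x) * prob q (avoidAll ends a₂ {a₁} ∩ clusterInEvent ends a₂ 𝓤) := by
  have h := slack_eq_expect q ends a₁ a₂ x 𝓤
  have h0 := expect_nonneg hq (slack_integrand_nonneg q ends hq a₁ a₂ x 𝓤)
  linarith

/-- **`marginfo ≥ 0`**: two monotonicity slacks times `1 − π_v ≥ 0`. -/
theorem marginfo_nonneg (hq : IsProbVec q) (o a₁ a₂ v b : V) :
    0 ≤ marginfo q ends o a₁ a₂ v b := by
  unfold marginfo
  have h1 := slack_nonneg q ends hq a₁ a₂ b {W | o ∈ W}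
  have h2 := slack_nonneg q ends hq a₁ a₂ o {W | b ∈ W}
  rw [← connEvent_eq_clusterInEvent] at h1 h2
  have e2 : avoidAll ends a₂ {a₁} ∩ (connEvent ends a₂ b ∩ connEvent ends a₁ o) =
      avoidAll ends a₂ {a₁} ∩ (connEvent ends a₁ o ∩ connEvent ends a₂ b) := by
    rw [Set.inter_comm (connEvent ends a₂ b)]
  rw [e2] at h2
  have hv := prob_le_one hq (connEvent ends a₁ v)
  exact mul_nonneg (by linarith) (by linarith)

/-- **`crossBfo ≥ 0`**: the monotonicity slack on the clusters containing `o` minus the slack on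
those containing `o` and `v` — the slack on the clusters containing `o` but not `v`. -/
theorem crossBfo_nonneg (hq : IsProbVec q) (o a₁ a₂ v b : V) :
    0 ≤ crossBfo q ends o a₁ a₂ v b := by
  unfold crossBfo
  have h1 := slack_eq_expect q ends a₁ a₂ b {W | o ∈ W}
  have h2 := slack_eq_expect q ends a₁ a₂ b {W | o ∈ W ∧ v ∈ W}
  rw [← connEvent_eq_clusterInEvent] at h1
  rw [← connEvent_pair_eq_clusterInEvent ends a₂ o v] at h2
  have e2 : avoidAll ends a₂ {a₁} ∩ (connEvent ends a₂ o ∩ connEvent ends a₂ v) =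
      avoidAll ends a₂ {a₁} ∩ (connEvent ends a₂ v ∩ connEvent ends a₂ o) := by
    rw [Set.inter_comm (connEvent ends a₂ o)]
  have e3 : avoidAll ends a₂ {a₁} ∩ (connEvent ends a₂ o ∩ connEvent ends a₂ v ∩ connEvent ends a₁ b) =
      avoidAll ends a₂ {a₁} ∩ (connEvent ends a₂ v ∩ (connEvent ends a₂ o ∩ connEvent ends a₁ b)) := by
    ext ω; simp only [Set.mem_inter_iff]; tauto
  rw [e2, e3] at h2
  rw [h1, h2, ← expect_sub]
  refine expect_nonneg hq fun ω => ?_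
  simp only [Pi.sub_apply]
  -- pointwise: `(1[o ∈ K] − 1[o ∈ K ∧ v ∈ K]) · (slack) ≥ 0`
  have hs : 0 ≤ prob q (connEvent ends a₁ b) * outsideProb q ends a₁ Set.univ (cluster ends ω a₂) -
      outsideProb q ends a₁ {W | b ∈ W} (cluster ends ω a₂) := by
    by_cases ha : a₁ ∈ cluster ends ω a₂
    · rw [outsideProb_apply_of_mem q _ ha, outsideProb_apply_of_mem q _ ha]; simp
    · rw [outsideProb_apply_of_notMem q _ ha, outsideProb_apply_of_notMem q _ ha, delClusterProb_univ]
      have hx := delClusterProb_le_beta q hq ends a₁ b (cluster ends ω a₂)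
      unfold beta at hx
      linarith
  have hi : {W : Set V | o ∈ W ∧ v ∈ W}.indicator (1 : Set V → R) (cluster ends ω a₂) ≤
      {W : Set V | o ∈ W}.indicator (1 : Set V → R) (cluster ends ω a₂) := by
    by_cases h : cluster ends ω a₂ ∈ {W : Set V | o ∈ W ∧ v ∈ W}
    · rw [Set.indicator_of_mem h, Set.indicator_of_mem (show cluster ends ω a₂ ∈ {W : Set V | o ∈ W} from h.1)]
    · rw [Set.indicator_of_notMem h]
      exact Set.indicator_apply_nonneg fun _ => zero_le_one
  nlinarith [hs, hi]

/-- **`B1h ≥ 0` at a pendant root, given the first-order mirror (B)-term**: the four other pieces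
are nonnegative outright (`crossAfo_nonneg`, a probability, two monotonicity-slack theorems). -/
theorem B1h_nonneg_pendant_root_of_crossB'fo {p : E → R} {e : E} {a₂ z : V} (hp : IsProbVec p)
    (he : p e ≠ 1) (hleaf : ∀ f, a₂ ∈ ends f → f = e) (hends : ends e = s(a₂, z)) {o a₁ v b : V}
    (ho : o ≠ a₂) (h1 : a₁ ≠ a₂) (hv : v ≠ a₂) (hb : b ≠ a₂)
    (hB' : 0 ≤ crossB'fo (Function.update p e 1) ends o a₁ a₂ v b) :
    0 ≤ B1h p ends o a₁ a₂ v b e := by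
  rw [B1h_eq_fo he hleaf hends ho h1 hv hb]
  have hq : IsProbVec (Function.update p e 1) := hp.update e zero_le_one le_rfl
  have hA := crossAfo_nonneg (Function.update p e 1) ends hq o a₁ a₂ v b
  have hA' := crossA'fo_nonneg (Function.update p e 1) ends hq o a₁ a₂ v b
  have hM := marginfo_nonneg (Function.update p e 1) ends hq o a₁ a₂ v b
  have hB := crossBfo_nonneg (Function.update p e 1) ends hq o a₁ a₂ v b
  linarith

end Nonneg

end LeafRowPendantRootFO

end Summit.Ventures.PercRepro2
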